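import Summits.KontsevichZagierPeriods.KontsevichZagierPeriods.Theses.CoactionDevissage
import Summits.KontsevichZagierPeriods.KontsevichZagierPeriods.Theorems.BetaCancellation.Negative.Torsion

/-!
# `Divisible` (stmt-KontsevichZagierPeriods-3170, route CoactionDevissage) — proof

The formal period group `KZ.FormalRep ⧸ KZ.relations` of the Kontsevich–Zagier move calculus is DIVISIBLE: for
`n ≠ 0` every class `c` has a `c'` with `c − n • c' ∈ KZ.relations` (`c' := scale (1/n) c`; `k • x ≡ scale k x`
modulo integrand additivity, `KZ.IntegralRep.of_constMul_nat_sub_nsmul_mem_relations`). This is already a tree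
theorem, `Summit.KontsevichZagierPeriods.KontsevichZagierPeriods.BetaCancellationNegative.exists_nsmul_sub_mem_relations`
(`Theorems/BetaCancellation/Negative/Torsion.lean`); this file closes the item by it (lead c10 of line `Sketch` of
crux `TateLifting`, banking calculus theorems where they close items). No new mathematics.
-/

namespace Summit.KontsevichZagierPeriods.CoactionDevissage

open Literature.NumberTheory.Transcendental

/-- Route `CoactionDevissage`, item stmt-KontsevichZagierPeriods-3170: `P_KZ` is divisible —
`n ≠ 0 → ∃ c', c − n • c' ∈ KZ.relations`. Proof: `BetaCancellationNegative.exists_nsmul_sub_mem_relations`.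
[folklore] -/
theorem divisible_proof :
    Summit.KontsevichZagierPeriods.KontsevichZagierPeriods.Theses.CoactionDevissage.Divisible := by
  intro n c hn
  exact Summit.KontsevichZagierPeriods.KontsevichZagierPeriods.BetaCancellationNegative.exists_nsmul_sub_mem_relations
    hn c

end Summit.KontsevichZagierPeriods.CoactionDevissage
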